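import Summits.QuantumFields.QCD.Theorems.QuarksAsStableActionStableActionBridgeTwistedTwoPoint
import Summits.QuantumFields.QCD.Theorems.QuarksAsStableActionStableActionBridgeTwistedExpectation

/-!
# Twisted connected correlators versus vacuum connected correlators (transfer-data form)
(crux `QuarksAsStableAction.StableActionBridge`, item stmt-QuantumFields-9737, line `Sketch`;
registered stub `twisted_connected_sub_vacuum_le`)

The lattice gap clause of the statement reads CONNECTED correlators `⟨A · τ_n B⟩ − ⟨A⟩⟨B⟩` of the
`(−1)^F`-twisted trace functional on a time-periodic torus of extent `L`.  In transfer-matrix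
language this is `N_AB / Z − (N_A / Z) (N_B / Z)` with `N_AB = Tr(Γ T^{L−n} A T^n B)`,
`N_A = Tr(Γ A T^L)`, `N_B = Tr(Γ B T^L)`, `Z = Tr(Γ T^L)`, while Goldstone lower bounds live in the
vacuum connected function `⟪Ω, A T^n B Ω⟫ − ⟪Ω, A Ω⟫ ⟪Ω, B Ω⟫`.  The theorem below bounds their
difference by `10 ‖A‖ ‖B‖ ε / (1 − ε)` with `ε := Re Tr T^{L−n} − 1 ≤ 1/2`.

Proof (bookkeeping over the landed transfer lemmas): with `a = ‖A‖`, `b = ‖B‖`,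
`r = ε / (1 − ε) ≤ 1`,
* `‖N_AB/Z − ⟪Ω, A T^n B Ω⟫‖ ≤ 2ab r` (`twisted_twoPoint_sub_vacuum_le`, p124046);
* `‖N_A/Z − ⟪Ω, A Ω⟫‖ ≤ 2a r`, `‖N_B/Z − ⟪Ω, B Ω⟫‖ ≤ 2b r`
  (`twisted_expectation_sub_vacuum_le_of_le`, p109817, with `L₀ := L − n ≤ L`);
* `‖⟪Ω, A Ω⟫‖ ≤ a`, `‖⟪Ω, B Ω⟫‖ ≤ b` (Cauchy–Schwarz), hence `‖N_B/Z‖ ≤ b + 2br ≤ 3b`;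
* `x y − p q = (x − p) y + p (y − q)` gives
  `‖(N_A/Z)(N_B/Z) − ⟪Ω,AΩ⟫⟪Ω,BΩ⟫‖ ≤ 2ar · 3b + a · 2br = 8ab r`,
and the triangle inequality yields `2ab r + 8ab r = 10ab r`.
-/

namespace Summit.QuantumFields.QCD.Cruxes.StableActionBridge.Sketch

open scoped InnerProductSpace ComplexOrder
open Literature.Probability.LatticeModels

/-- **Twisted connected correlator vs vacuum connected correlator.**  For transfer data
`D = (T, Ω)` on a finite-dimensional Hilbert space, a contraction `Γ` with `Γ Ω = Ω` commuting
with `T`, bounded `A, B`, `n ≤ L` and `ε := Re Tr T^{L−n} − 1 ≤ 1/2`: with `Z := Tr(Γ T^L)`,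
`‖(Tr(Γ T^{L−n} A T^n B)/Z − (Tr(Γ A T^L)/Z)(Tr(Γ B T^L)/Z)) − (⟪Ω, A T^n B Ω⟫ − ⟪Ω,AΩ⟫⟪Ω,BΩ⟫)‖
  ≤ 10 ‖A‖ ‖B‖ ε / (1 − ε)`. [folklore] -/
theorem twisted_connected_sub_vacuum_le :
    ∀ (H : Type) [NormedAddCommGroup H] [InnerProductSpace ℂ H] [CompleteSpace H]
      [FiniteDimensional ℂ H] (D : TransferData H) (Γ A B : H →L[ℂ] H),
      ‖Γ‖ ≤ 1 → Γ D.vacuum = D.vacuum → Γ * D.T = D.T * Γ → ∀ L n : ℕ, n ≤ L →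
        (LinearMap.trace ℂ H ((D.T ^ (L - n) : H →L[ℂ] H) : H →ₗ[ℂ] H)).re - 1 ≤ 1 / 2 →
          ‖(LinearMap.trace ℂ H
                    ((Γ * D.T ^ (L - n) * A * D.T ^ n * B : H →L[ℂ] H) : H →ₗ[ℂ] H) /
                  LinearMap.trace ℂ H ((Γ * D.T ^ L : H →L[ℂ] H) : H →ₗ[ℂ] H) -
                (LinearMap.trace ℂ H ((Γ * A * D.T ^ L : H →L[ℂ] H) : H →ₗ[ℂ] H) /
                    LinearMap.trace ℂ H ((Γ * D.T ^ L : H →L[ℂ] H) : H →ₗ[ℂ] H)) *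
                  (LinearMap.trace ℂ H ((Γ * B * D.T ^ L : H →L[ℂ] H) : H →ₗ[ℂ] H) /
                    LinearMap.trace ℂ H ((Γ * D.T ^ L : H →L[ℂ] H) : H →ₗ[ℂ] H))) -
              (⟪D.vacuum, (A * D.T ^ n * B) D.vacuum⟫_ℂ -
                ⟪D.vacuum, A D.vacuum⟫_ℂ * ⟪D.vacuum, B D.vacuum⟫_ℂ)‖ ≤
            10 * (‖A‖ * ‖B‖) *
                ((LinearMap.trace ℂ H ((D.T ^ (L - n) : H →L[ℂ] H) : H →ₗ[ℂ] H)).re - 1) /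
              (1 - ((LinearMap.trace ℂ H ((D.T ^ (L - n) : H →L[ℂ] H) : H →ₗ[ℂ] H)).re - 1)) := by
  intro H _ _ _ _ D Γ A B hΓ hΓΩ hcomm L n hn hε
  -- abbreviations
  set ε : ℝ := (LinearMap.trace ℂ H ((D.T ^ (L - n) : H →L[ℂ] H) : H →ₗ[ℂ] H)).re - 1
  set Z : ℂ := LinearMap.trace ℂ H ((Γ * D.T ^ L : H →L[ℂ] H) : H →ₗ[ℂ] H)
  set w : ℂ := LinearMap.trace ℂ H
      ((Γ * D.T ^ (L - n) * A * D.T ^ n * B : H →L[ℂ] H) : H →ₗ[ℂ] H) / Z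
  set x : ℂ := LinearMap.trace ℂ H ((Γ * A * D.T ^ L : H →L[ℂ] H) : H →ₗ[ℂ] H) / Z
  set y : ℂ := LinearMap.trace ℂ H ((Γ * B * D.T ^ L : H →L[ℂ] H) : H →ₗ[ℂ] H) / Z
  set tAB : ℂ := ⟪D.vacuum, (A * D.T ^ n * B) D.vacuum⟫_ℂ
  set tA : ℂ := ⟪D.vacuum, A D.vacuum⟫_ℂ
  set tB : ℂ := ⟪D.vacuum, B D.vacuum⟫_ℂ
  have hε1 : ε < 1 := by linarith
  have hr0 : 0 < 1 - ε := by linarith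
  -- the three landed transfer bounds (two-point ratio, one-insertion ratios at `L₀ := L - n`)
  have h1 : ‖w - tAB‖ ≤ 2 * (‖A‖ * ‖B‖) * ε / (1 - ε) :=
    twisted_twoPoint_sub_vacuum_le H D Γ A B hΓ hΓΩ hcomm L n hn hε1
  have h2 : ‖x - tA‖ ≤ 2 * ‖A‖ * ε / (1 - ε) :=
    twisted_expectation_sub_vacuum_le_of_le H D Γ A hΓ hΓΩ (L - n) L (Nat.sub_le L n) hε1
  have h3 : ‖y - tB‖ ≤ 2 * ‖B‖ * ε / (1 - ε) :=
    twisted_expectation_sub_vacuum_le_of_le H D Γ B hΓ hΓΩ (L - n) L (Nat.sub_le L n) hε1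
  -- Cauchy–Schwarz for the vacuum expectations
  have htA_le : ‖tA‖ ≤ ‖A‖ := by
    calc ‖tA‖ ≤ ‖D.vacuum‖ * ‖A D.vacuum‖ := norm_inner_le_norm _ _
      _ ≤ ‖D.vacuum‖ * (‖A‖ * ‖D.vacuum‖) :=
          mul_le_mul_of_nonneg_left (A.le_opNorm _) (norm_nonneg _)
      _ = ‖A‖ := by rw [D.norm_vacuum]; ring
  have htB_le : ‖tB‖ ≤ ‖B‖ := by
    calc ‖tB‖ ≤ ‖D.vacuum‖ * ‖B D.vacuum‖ := norm_inner_le_norm _ _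
      _ ≤ ‖D.vacuum‖ * (‖B‖ * ‖D.vacuum‖) :=
          mul_le_mul_of_nonneg_left (B.le_opNorm _) (norm_nonneg _)
      _ = ‖B‖ := by rw [D.norm_vacuum]; ring
  -- pass to `r := ε / (1 - ε) ≤ 1`
  rw [mul_div_assoc] at h1 h2 h3 ⊢
  set r : ℝ := ε / (1 - ε) with hr
  have hr1 : r ≤ 1 := by
    rw [hr, div_le_one hr0]
    linarith
  -- `‖N_B / Z‖ ≤ b + 2 b r ≤ 3 b`
  have hy_le : ‖y‖ ≤ 3 * ‖B‖ := by
    have h := norm_le_insert' y tB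
    have h2B : 2 * ‖B‖ * r ≤ 2 * ‖B‖ := by
      have := mul_le_mul_of_nonneg_left hr1 (by positivity : (0 : ℝ) ≤ 2 * ‖B‖)
      rwa [mul_one] at this
    linarith
  -- `w - x y - (tAB - tA tB) = (w - tAB) - ((x - tA) y + tA (y - tB))`
  have hdec : w - x * y - (tAB - tA * tB) = (w - tAB) - ((x - tA) * y + tA * (y - tB)) := by
    ring
  rw [hdec]
  have hxy : ‖(x - tA) * y‖ ≤ 2 * ‖A‖ * r * (3 * ‖B‖) := by
    rw [norm_mul]
    exact mul_le_mul h2 hy_le (norm_nonneg _) ((norm_nonneg _).trans h2)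
  have hAy : ‖tA * (y - tB)‖ ≤ ‖A‖ * (2 * ‖B‖ * r) := by
    rw [norm_mul]
    exact mul_le_mul htA_le h3 (norm_nonneg _) (norm_nonneg _)
  calc ‖w - tAB - ((x - tA) * y + tA * (y - tB))‖
      ≤ ‖w - tAB‖ + (‖(x - tA) * y‖ + ‖tA * (y - tB)‖) :=
        (norm_sub_le _ _).trans (add_le_add le_rfl (norm_add_le _ _))
    _ ≤ 2 * (‖A‖ * ‖B‖) * r + (2 * ‖A‖ * r * (3 * ‖B‖) + ‖A‖ * (2 * ‖B‖ * r)) :=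
        add_le_add h1 (add_le_add hxy hAy)
    _ = 10 * (‖A‖ * ‖B‖) * r := by ring

end Summit.QuantumFields.QCD.Cruxes.StableActionBridge.Sketch
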